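import Literature.Analysis.Complex.ThreeChamberConfig
import Mathlib.Analysis.SpecialFunctions.Complex.Circle
import HarnessLib

/-!
# The three-chamber configuration, II: the level crosscut, gate hits, loops through three arcs

Topic: Analysis / Complex. Second file of the tree's rendering of the proof of Lemma 5.4 of
G. F. Lawler, O. Schramm, W. Werner, Ann. Probab. **32** (2004) ("Let
`α := {z ∈ D : |ψ_D(z) - ψ_D(w)| = ε₁}` … Suppose for the moment that `α` intersects `A₁` and
`A₂`. Consider a subarc `α' ⊂ α` whose endpoints are in `A₁` and `A₂`, which is minimal with
respect to inclusion"). For a `Setup` `S` (see `ThreeChamberConfig.lean`) we provide: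

* **loops through three arcs** (`isJordanLoop_triLoop`, generic): two arcs `g₁, g₂` from a
  common base point and a third arc `β` joining their far ends, pairwise meeting only at the
  expected endpoints, assemble (via `PlaneTopology.quadLoop`, splitting `β` in halves) into a
  Jordan loop with range `g₁[0,1] ∪ β[0,1] ∪ g₂[0,1]`;
* **the level crosscut** `α(θ) = F(c + ε e^{iθ})` (`Setup.levelArc`) on the explicit parameter
  interval `I_α = (arg c + arccos κ, arg c + 2π - arccos κ)`,
  `κ = (1 - ‖c‖² - ε²)/(2ε‖c‖)`, where the circle `{|w - c| = ε}` runs inside the unit disc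
  (`Setup.circleMap_mem_ball_iff`, by the monotonicity of `cos` on `[0, π]`): it is continuous,
  injective, has values in the level set `{z ∈ Ω : ‖ψ z - c‖ = ε}` and covers it
  (`Setup.exists_levelArc_eq`);
* **the closed gates** `gate 0 = (0, x]`, `gate 1 = σ [0, τ₊)`, `gate 2 = σ (τ₋, 0]`
  (`Setup.gate`), relatively closed in `Ω`, contained in `G`, pairwise meeting only at `x`;
* **selection of a clean sub-arc between hits of two different gates**
  (`exists_clean_subinterval`, generic): given hit parameter sets `H m = I ∩ α⁻¹(C m)`
  (`C m` closed, `α` continuous on the open interval `I`), pairwise disjoint, and parameters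
  `s < t` in `I` hitting different gates, there are `s ≤ s' < t' ≤ t` hitting different gates
  with `(s', t')` free of hits.

Everything here is proved.

## References

* G. F. Lawler, O. Schramm, W. Werner, Ann. Probab. 32 (2004), proof of Lemma 5.4.
  [LawlerSchrammWerner2004]
-/

noncomputable section

open Set Filter Metric Function Complex Real
open _root_.Topology
open Literature.Topology.PlaneTopology

namespace Literature.Analysis.Complex

namespace ThreeChamber

/-! ### Loops through three arcs -/

section TriLoop

variable {g₁ g₂ β : ℝ → ℂ}

/-- Extension of an arc on `[0, 1]` to a continuous map on `ℝ` (constant outside). [folklore] -/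
def ext01 (γ : ℝ → ℂ) (u : ℝ) : ℂ := γ (projIcc 0 1 zero_le_one u)

/-- `ext01 γ` agrees with `γ` on `[0, 1]`. [folklore] -/
theorem ext01_apply {γ : ℝ → ℂ} {u : ℝ} (hu : u ∈ Icc (0 : ℝ) 1) : ext01 γ u = γ u := by
  rw [ext01, projIcc_of_mem _ hu]

/-- `ext01 γ` is continuous when `γ` is continuous on `[0, 1]`. [folklore] -/
theorem continuous_ext01 {γ : ℝ → ℂ} (h : ContinuousOn γ (Icc 0 1)) : Continuous (ext01 γ) :=
  h.comp_continuous continuous_projIcc.subtype_val fun u ↦ (projIcc 0 1 zero_le_one u).2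

/-- `ext01 γ` and `γ` have the same trace on `[0, 1]`. [folklore] -/
theorem image_ext01 (γ : ℝ → ℂ) : ext01 γ '' Icc 0 1 = γ '' Icc 0 1 :=
  image_congr fun _ hu ↦ ext01_apply hu

/-- `ext01 γ` is injective on `[0, 1]` when `γ` is. [folklore] -/
theorem injOn_ext01 {γ : ℝ → ℂ} (h : InjOn γ (Icc 0 1)) : InjOn (ext01 γ) (Icc 0 1) :=
  fun u hu v hv huv ↦ h hu hv (by rwa [ext01_apply hu, ext01_apply hv] at huv)

/-- **The loop through three arcs**: `g₁` from the base point to `β 0`, `β` (split in halves),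
and `g₂` backwards from `β 1` to the base point. [folklore] -/
def triLoop (g₁ β g₂ : ℝ → ℂ) : ℝ → ℂ :=
  quadLoop (ext01 g₁) (ext01 fun u ↦ β (u / 2)) (ext01 fun u ↦ β (1 / 2 + u / 2))
    (ext01 fun u ↦ g₂ (1 - u))

/-- **A loop through three arcs pairwise meeting only at their common endpoints is a Jordan
loop**, with range the union of the three traces. [folklore] -/
theorem isJordanLoop_triLoop (hg₁c : ContinuousOn g₁ (Icc 0 1)) (hg₂c : ContinuousOn g₂ (Icc 0 1))
    (hβc : ContinuousOn β (Icc 0 1)) (hg₁i : InjOn g₁ (Icc 0 1)) (hg₂i : InjOn g₂ (Icc 0 1))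
    (hβi : InjOn β (Icc 0 1)) (h0 : g₁ 0 = g₂ 0) (hβ0 : β 0 = g₁ 1) (hβ1 : β 1 = g₂ 1)
    (h12 : g₁ '' Icc 0 1 ∩ g₂ '' Icc 0 1 ⊆ {g₁ 0}) (h1β : g₁ '' Icc 0 1 ∩ β '' Icc 0 1 ⊆ {g₁ 1})
    (h2β : g₂ '' Icc 0 1 ∩ β '' Icc 0 1 ⊆ {g₂ 1}) :
    IsJordanLoop (triLoop g₁ β g₂) ∧
      range (triLoop g₁ β g₂) = g₁ '' Icc 0 1 ∪ β '' Icc 0 1 ∪ g₂ '' Icc 0 1 := by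
  -- the four arcs
  set γ₀ : ℝ → ℂ := ext01 g₁ with hγ₀
  set γ₁ : ℝ → ℂ := ext01 fun u ↦ β (u / 2) with hγ₁
  set γ₂ : ℝ → ℂ := ext01 fun u ↦ β (1 / 2 + u / 2) with hγ₂
  set γ₃ : ℝ → ℂ := ext01 fun u ↦ g₂ (1 - u) with hγ₃
  have hm1 : ∀ u ∈ Icc (0 : ℝ) 1, u / 2 ∈ Icc (0 : ℝ) 1 := fun u hu ↦
    ⟨by linarith [hu.1], by linarith [hu.2]⟩
  have hm2 : ∀ u ∈ Icc (0 : ℝ) 1, 1 / 2 + u / 2 ∈ Icc (0 : ℝ) 1 := fun u hu ↦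
    ⟨by linarith [hu.1], by linarith [hu.2]⟩
  have hm3 : ∀ u ∈ Icc (0 : ℝ) 1, 1 - u ∈ Icc (0 : ℝ) 1 := fun u hu ↦
    ⟨by linarith [hu.2], by linarith [hu.1]⟩
  -- continuity
  have hc₀ : Continuous γ₀ := continuous_ext01 hg₁c
  have hc₁ : Continuous γ₁ := continuous_ext01 (hβc.comp (by fun_prop) hm1)
  have hc₂ : Continuous γ₂ := continuous_ext01 (hβc.comp (by fun_prop) hm2)
  have hc₃ : Continuous γ₃ := continuous_ext01 (hg₂c.comp (by fun_prop) hm3)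
  -- images
  have him₀ : γ₀ '' Icc 0 1 = g₁ '' Icc 0 1 := image_ext01 g₁
  have him₁ : γ₁ '' Icc 0 1 = β '' Icc 0 (1 / 2) := by
    rw [hγ₁, image_ext01]
    ext z; constructor
    · rintro ⟨u, hu, rfl⟩; exact ⟨u / 2, ⟨by linarith [hu.1], by linarith [hu.2]⟩, rfl⟩
    · rintro ⟨v, hv, rfl⟩; exact ⟨2 * v, ⟨by linarith [hv.1], by linarith [hv.2]⟩, by simp⟩
  have him₂ : γ₂ '' Icc 0 1 = β '' Icc (1 / 2) 1 := by
    rw [hγ₂, image_ext01]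
    ext z; constructor
    · rintro ⟨u, hu, rfl⟩; exact ⟨1 / 2 + u / 2, ⟨by linarith [hu.1], by linarith [hu.2]⟩, rfl⟩
    · rintro ⟨v, hv, rfl⟩
      exact ⟨2 * v - 1, ⟨by linarith [hv.1], by linarith [hv.2]⟩, by
        show β (1 / 2 + (2 * v - 1) / 2) = β v; congr 1; ring⟩
  have him₃ : γ₃ '' Icc 0 1 = g₂ '' Icc 0 1 := by
    rw [hγ₃, image_ext01]
    ext z; constructor
    · rintro ⟨u, hu, rfl⟩; exact ⟨1 - u, hm3 u hu, rfl⟩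
    · rintro ⟨v, hv, rfl⟩; exact ⟨1 - v, hm3 v hv, by simp⟩
  have himβ : β '' Icc 0 (1 / 2) ∪ β '' Icc (1 / 2) 1 = β '' Icc 0 1 := by
    rw [← image_union, Icc_union_Icc_eq_Icc (by norm_num) (by norm_num)]
  have hsub₁ : β '' Icc 0 (1 / 2) ⊆ β '' Icc 0 1 := image_mono (Icc_subset_Icc_right (by norm_num))
  have hsub₂ : β '' Icc (1 / 2) 1 ⊆ β '' Icc 0 1 := image_mono (Icc_subset_Icc_left (by norm_num))
  -- junctions
  have hj : QuadJunction γ₀ γ₁ γ₂ γ₃ := by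
    refine ⟨?_, ?_, ?_, ?_⟩
    · rw [hγ₀, hγ₁, ext01_apply (right_mem_Icc.2 zero_le_one), ext01_apply (left_mem_Icc.2 zero_le_one)]
      simp [hβ0]
    · rw [hγ₁, hγ₂, ext01_apply (right_mem_Icc.2 zero_le_one), ext01_apply (left_mem_Icc.2 zero_le_one)]
      norm_num
    · rw [hγ₂, hγ₃, ext01_apply (right_mem_Icc.2 zero_le_one), ext01_apply (left_mem_Icc.2 zero_le_one)]
      norm_num [hβ1]
    · rw [hγ₃, hγ₀, ext01_apply (right_mem_Icc.2 zero_le_one), ext01_apply (left_mem_Icc.2 zero_le_one)]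
      simp [h0]
  -- injectivity of the arcs
  have hi₀ : InjOn γ₀ (Icc 0 1) := injOn_ext01 hg₁i
  have hi₁ : InjOn γ₁ (Icc 0 1) := injOn_ext01 fun u hu v hv huv ↦ by
    have := hβi (hm1 u hu) (hm1 v hv) huv; linarith
  have hi₂ : InjOn γ₂ (Icc 0 1) := injOn_ext01 fun u hu v hv huv ↦ by
    have := hβi (hm2 u hu) (hm2 v hv) huv; linarith
  have hi₃ : InjOn γ₃ (Icc 0 1) := injOn_ext01 fun u hu v hv huv ↦ by
    have := hg₂i (hm3 u hu) (hm3 v hv) huv; linarith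
  -- values at the junction points
  have hγ₁0 : γ₁ 0 = β 0 := by rw [hγ₁, ext01_apply (left_mem_Icc.2 zero_le_one)]; simp
  have hγ₂0 : γ₂ 0 = β (1 / 2) := by rw [hγ₂, ext01_apply (left_mem_Icc.2 zero_le_one)]; simp
  have hγ₃0 : γ₃ 0 = g₂ 1 := by rw [hγ₃, ext01_apply (left_mem_Icc.2 zero_le_one)]; simp
  have hγ₀0 : γ₀ 0 = g₁ 0 := by rw [hγ₀, ext01_apply (left_mem_Icc.2 zero_le_one)]
  -- `β 0 ∉ β[1/2, 1]`, `β 1 ∉ β[0, 1/2]`, the two halves meet only at `β (1/2)`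
  have hβ0n : β 0 ∉ β '' Icc (1 / 2) 1 := by
    rintro ⟨v, hv, hv0⟩
    have := hβi ⟨by linarith [hv.1], hv.2⟩ (left_mem_Icc.2 zero_le_one) hv0
    linarith [hv.1]
  have hβ1n : β 1 ∉ β '' Icc 0 (1 / 2) := by
    rintro ⟨v, hv, hv1⟩
    have := hβi ⟨hv.1, by linarith [hv.2]⟩ (right_mem_Icc.2 zero_le_one) hv1
    linarith [hv.2]
  have hhalves : β '' Icc 0 (1 / 2) ∩ β '' Icc (1 / 2) 1 ⊆ {β (1 / 2)} := by
    rintro z ⟨⟨u, hu, rfl⟩, ⟨v, hv, huv⟩⟩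
    have := hβi ⟨by linarith [hv.1], hv.2⟩ ⟨hu.1, by linarith [hu.2]⟩ huv
    rw [mem_singleton_iff]
    congr 1
    linarith [hu.2, hv.1]
  -- the loop
  have htri : triLoop g₁ β g₂ = quadLoop γ₀ γ₁ γ₂ γ₃ := rfl
  have hinj : InjOn (triLoop g₁ β g₂) (Ico 0 1) := by
    rw [htri]
    refine injOn_quadLoop hj hi₀ hi₁ hi₂ hi₃ ?_ ?_ ?_ ?_ ?_ ?_
    · rw [him₀, him₁, hγ₁0, hβ0]
      exact fun z hz ↦ h1β ⟨hz.1, hsub₁ hz.2⟩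
    · rw [him₁, him₂, hγ₂0]; exact hhalves
    · rw [him₂, him₃, hγ₃0]
      exact fun z hz ↦ h2β ⟨hz.2, hsub₂ hz.1⟩
    · rw [him₃, him₀, hγ₀0]
      exact fun z hz ↦ h12 ⟨hz.2, hz.1⟩
    · rw [him₀, him₂, Set.disjoint_left]
      intro z hz hz'
      have h1 : z = g₁ 1 := h1β ⟨hz, hsub₂ hz'⟩
      rw [h1, ← hβ0] at hz'
      exact hβ0n hz'
    · rw [him₁, him₃, Set.disjoint_left]
      intro z hz hz'
      have h1 : z = g₂ 1 := h2β ⟨hz', hsub₁ hz⟩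
      rw [h1, ← hβ1] at hz
      exact hβ1n hz
  refine ⟨⟨continuous_quadLoop hj hc₀ hc₁ hc₂ hc₃, periodic_quadLoop, hinj⟩, ?_⟩
  rw [triLoop, range_quadLoop hj, him₀, him₁, him₂, him₃, union_assoc (g₁ '' Icc 0 1), himβ]

end TriLoop

/-! ### Clean sub-arcs between hits of different gates -/

/-- **Selecting a clean sub-arc.** Let `α` be continuous on the open interval `I`, let
`C 0, C 1, C 2` be closed sets with pairwise disjoint hit sets `H m = I ∩ α⁻¹(C m)`, and let
`s < t` in `I` with `s ∈ H i`, `t ∈ H k`, `i ≠ k`. Then there are `s ≤ s' < t' ≤ t` and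
`i' ≠ k'` with `s' ∈ H i'`, `t' ∈ H k'` and `(s', t')` free of hits. [folklore] -/
theorem exists_clean_subinterval {α : ℝ → ℂ} {p q : ℝ} (hα : ContinuousOn α (Ioo p q))
    (C : Fin 3 → Set ℂ) (hC : ∀ m, IsClosed (C m))
    (hdisj : ∀ m m', m ≠ m' → ∀ θ ∈ Ioo p q, α θ ∈ C m → α θ ∉ C m')
    {s t : ℝ} (hst : s < t) (hs : s ∈ Ioo p q) (ht : t ∈ Ioo p q) {i k : Fin 3} (hik : i ≠ k)
    (hsi : α s ∈ C i) (htk : α t ∈ C k) :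
    ∃ s' t' : ℝ, s ≤ s' ∧ s' < t' ∧ t' ≤ t ∧ ∃ i' k' : Fin 3, i' ≠ k' ∧ α s' ∈ C i' ∧ α t' ∈ C k' ∧
      ∀ θ ∈ Ioo s' t', ∀ m, α θ ∉ C m := by
  have hIcc : Icc s t ⊆ Ioo p q := fun θ hθ ↦ ⟨hs.1.trans_le hθ.1, hθ.2.trans_lt ht.2⟩
  have hαc : ContinuousOn α (Icc s t) := hα.mono hIcc
  -- closed hit sets inside `[s, t]`
  have hclosed : ∀ m (d : ℝ), IsClosed {θ ∈ Icc s d | θ ≤ t ∧ α θ ∈ C m} := by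
    intro m d
    have h1 : IsClosed (Icc s t ∩ α ⁻¹' C m) := hαc.preimage_isClosed_of_isClosed isClosed_Icc (hC m)
    have : {θ ∈ Icc s d | θ ≤ t ∧ α θ ∈ C m} = (Icc s t ∩ α ⁻¹' C m) ∩ Iic d := by
      ext θ
      simp only [mem_setOf_eq, mem_inter_iff, mem_Icc, mem_preimage, mem_Iic]
      constructor
      · rintro ⟨⟨h1, h2⟩, h3, h4⟩; exact ⟨⟨⟨h1, h3⟩, h4⟩, h2⟩
      · rintro ⟨⟨⟨h1, h3⟩, h4⟩, h2⟩; exact ⟨⟨h1, h2⟩, h3, h4⟩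
    rw [this]
    exact h1.inter isClosed_Iic
  -- `t'`: the first hit of a gate other than `i` after `s`
  set D : Set ℝ := {θ ∈ Icc s t | θ ≤ t ∧ ∃ m, m ≠ i ∧ α θ ∈ C m} with hD
  have hDclosed : IsClosed D := by
    have : D = ⋃ m ∈ ({m | m ≠ i} : Set (Fin 3)), {θ ∈ Icc s t | θ ≤ t ∧ α θ ∈ C m} := by
      ext θ
      simp only [hD, mem_setOf_eq, mem_iUnion, exists_prop]
      constructor
      · rintro ⟨h1, h2, m, hm, h3⟩; exact ⟨m, hm, h1, h2, h3⟩
      · rintro ⟨m, hm, h1, h2, h3⟩; exact ⟨h1, h2, m, hm, h3⟩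
    rw [this]
    exact Set.Finite.isClosed_biUnion (Set.toFinite _) fun m _ ↦ hclosed m t
  have htD : t ∈ D := ⟨right_mem_Icc.2 hst.le, le_rfl, k, hik.symm, htk⟩
  have hDbdd : BddBelow D := ⟨s, fun θ hθ ↦ hθ.1.1⟩
  set t' : ℝ := sInf D with ht'
  have ht'D : t' ∈ D := hDclosed.csInf_mem ⟨t, htD⟩ hDbdd
  obtain ⟨⟨hst', ht't⟩, -, k', hk'i, ht'k'⟩ := ht'D
  have hnoD : ∀ θ ∈ Ico s t', ∀ m, m ≠ i → α θ ∉ C m := by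
    intro θ hθ m hm hαm
    have : t' ≤ θ := csInf_le hDbdd ⟨⟨hθ.1, hθ.2.le.trans ht't⟩, hθ.2.le.trans ht't, m, hm, hαm⟩
    exact (not_le.2 hθ.2) this
  -- `s'`: the last hit of gate `i` before `t'`
  set B : Set ℝ := {θ ∈ Icc s t' | θ ≤ t ∧ α θ ∈ C i} with hB
  have hBclosed : IsClosed B := hclosed i t'
  have hsB : s ∈ B := ⟨left_mem_Icc.2 hst', hst.le, hsi⟩
  have hBbdd : BddAbove B := ⟨t', fun θ hθ ↦ hθ.1.2⟩
  set s' : ℝ := sSup B with hs'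
  have hs'B : s' ∈ B := hBclosed.csSup_mem ⟨s, hsB⟩ hBbdd
  obtain ⟨⟨hss', hs't'⟩, -, hs'i⟩ := hs'B
  have hnoB : ∀ θ ∈ Ioc s' t', α θ ∉ C i := by
    intro θ hθ hαi
    have : θ ≤ s' := le_csSup hBbdd ⟨⟨hss'.trans hθ.1.le, hθ.2⟩, hθ.2.trans ht't, hαi⟩
    exact (not_le.2 hθ.1) this
  -- `s' < t'` by disjointness of the hit sets
  have hs't'lt : s' < t' := by
    rcases eq_or_lt_of_le hs't' with h | h
    · exfalso
      have hmem : t' ∈ Ioo p q := hIcc ⟨hst', ht't⟩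
      rw [← h] at ht'k'
      exact hdisj i k' hk'i.symm s' (hIcc ⟨hss', hs't'.trans ht't⟩) hs'i ht'k'
    · exact h
  refine ⟨s', t', hss', hs't'lt, ht't, i, k', hk'i.symm, hs'i, ht'k', fun θ hθ m ↦ ?_⟩
  by_cases hm : m = i
  · rw [hm]; exact hnoB θ ⟨hθ.1, hθ.2.le⟩
  · exact hnoD θ ⟨hss'.trans hθ.1.le, hθ.2⟩ m hm

/-! ### The level crosscut -/

namespace Setup

variable (S : Setup)

/-- `circleMap` is injective on intervals of length `< 2π`. [folklore] -/
theorem _root_.Literature.Analysis.Complex.ThreeChamber.injOn_circleMap_of_lt {c' : ℂ} {R : ℝ}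
    (hR : R ≠ 0) {p q : ℝ} (hpq : q - p < 2 * π) : InjOn (circleMap c' R) (Icc p q) := by
  intro u hu v hv huv
  refine eq_of_circleMap_eq hR ?_ huv
  rw [abs_lt]
  constructor <;> linarith [hu.1, hu.2, hv.1, hv.2]

section Level

variable {ε : ℝ}

/-- The threshold `κ = (1 - ‖c‖² - ε²) / (2 ε ‖c‖)`. [folklore] -/
def kappa (S : Setup) (ε : ℝ) : ℝ := (1 - ‖S.c‖ ^ 2 - ε ^ 2) / (2 * ε * ‖S.c‖)

/-- The parameter interval `I_α = (arg c + arccos κ, arg c + 2π - arccos κ)` of the part of the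
circle `{|w - c| = ε}` inside the unit disc. [cite: LawlerSchrammWerner2004, proof of Lemma 5.4] -/
def levelLo (S : Setup) (ε : ℝ) : ℝ := arg S.c + arccos (S.kappa ε)

/-- The upper end of the parameter interval `I_α`. [folklore] -/
def levelHi (S : Setup) (ε : ℝ) : ℝ := arg S.c + 2 * π - arccos (S.kappa ε)

/-- **The level crosscut `α(θ) = F(c + ε e^{iθ})`.**
[cite: LawlerSchrammWerner2004, proof of Lemma 5.4] -/
def levelArc (S : Setup) (ε : ℝ) (θ : ℝ) : ℂ := S.F (circleMap S.c ε θ)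

/-- `c ∈ 𝔻`. [folklore] -/
theorem norm_c_lt : ‖S.c‖ < 1 := mem_ball_zero_iff.1 (S.ψ_maps S.x_mem)

/-- `‖c + ε e^{iθ}‖² = ‖c‖² + ε² + 2 ε ‖c‖ cos (θ - arg c)`. [folklore] -/
theorem norm_sq_circleMap (θ : ℝ) :
    ‖circleMap S.c ε θ‖ ^ 2 = ‖S.c‖ ^ 2 + ε ^ 2 + 2 * ε * ‖S.c‖ * Real.cos (θ - arg S.c) := by
  have hc : S.c = (‖S.c‖ : ℂ) * exp (arg S.c * I) := (norm_mul_exp_arg_mul_I S.c).symm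
  rw [circleMap, Complex.sq_norm, Complex.normSq_apply]
  conv_lhs => rw [hc]
  simp only [add_re, mul_re, ofReal_re, ofReal_im, zero_mul, sub_zero, add_im, mul_im, add_zero,
    Complex.exp_ofReal_mul_I_re, Complex.exp_ofReal_mul_I_im]
  rw [Real.cos_sub]
  nlinarith [Real.sin_sq_add_cos_sq θ, Real.sin_sq_add_cos_sq (arg S.c), Complex.sq_norm S.c]

variable (hε0 : 0 < ε) (hε1 : ε < 1) (hcε : 1 - ‖S.c‖ < ε)
include hε0 hε1 hcε

omit hε0 in
/-- `c ≠ 0` (indeed `‖c‖ > 1 - ε > 0`). [folklore] -/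
theorem norm_c_pos : 0 < ‖S.c‖ := by linarith

/-- `-1 < κ < 1`. [folklore] -/
theorem kappa_mem : S.kappa ε ∈ Ioo (-1 : ℝ) 1 := by
  have hc := S.norm_c_pos hε1 hcε
  have hc1 := S.norm_c_lt
  have hden : 0 < 2 * ε * ‖S.c‖ := by positivity
  rw [kappa, mem_Ioo, div_lt_iff₀ hden, lt_div_iff₀ hden]
  constructor <;> nlinarith

/-- **The circle runs inside the disc exactly over `I_α`**: for `θ - arg c ∈ (0, 2π)`,
`c + ε e^{iθ} ∈ 𝔻 ↔ θ ∈ I_α`. [folklore] -/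
theorem circleMap_mem_ball_iff {θ : ℝ} (hθ : θ - arg S.c ∈ Ioo 0 (2 * π)) :
    circleMap S.c ε θ ∈ ball (0 : ℂ) 1 ↔ θ ∈ Ioo (S.levelLo ε) (S.levelHi ε) := by
  have hc := S.norm_c_pos hε1 hcε
  obtain ⟨hκ1, hκ2⟩ := S.kappa_mem hε0 hε1 hcε
  have hden : 0 < 2 * ε * ‖S.c‖ := by positivity
  -- `‖·‖ < 1 ↔ cos (θ - arg c) < κ`
  have key : circleMap S.c ε θ ∈ ball (0 : ℂ) 1 ↔ Real.cos (θ - arg S.c) < S.kappa ε := by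
    rw [mem_ball_zero_iff, ← sq_lt_one_iff₀ (norm_nonneg _), S.norm_sq_circleMap, kappa,
      lt_div_iff₀ hden]
    constructor <;> intro h <;> nlinarith
  rw [key]
  set φ : ℝ := θ - arg S.c with hφ
  have hA0 : 0 ≤ arccos (S.kappa ε) := arccos_nonneg _
  have hAπ : arccos (S.kappa ε) < π := arccos_lt_pi.2 hκ1
  have hcosA : Real.cos (arccos (S.kappa ε)) = S.kappa ε := cos_arccos hκ1.le hκ2.le
  -- reduce to `φ ∈ (arccos κ, 2π - arccos κ)`
  have hiff : Real.cos φ < S.kappa ε ↔ arccos (S.kappa ε) < φ ∧ φ < 2 * π - arccos (S.kappa ε) := by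
    rcases le_or_gt φ π with hφπ | hφπ
    · -- `φ ∈ (0, π]`: `cos` is strictly decreasing
      constructor
      · intro h
        refine ⟨?_, by linarith⟩
        by_contra hle; push Not at hle
        have : Real.cos (arccos (S.kappa ε)) ≤ Real.cos φ :=
          (strictAntiOn_cos.le_iff_ge ⟨hA0, hAπ.le⟩ ⟨hφ ▸ hθ.1.le, hφπ⟩).2 hle
        rw [hcosA] at this; linarith
      · rintro ⟨h1, -⟩
        have : Real.cos φ < Real.cos (arccos (S.kappa ε)) :=
          strictAntiOn_cos ⟨hA0, hAπ.le⟩ ⟨hφ ▸ hθ.1.le, hφπ⟩ h1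
        rwa [hcosA] at this
    · -- `φ ∈ (π, 2π)`: use `cos φ = cos (2π - φ)`
      have hcos : Real.cos φ = Real.cos (2 * π - φ) := by rw [Real.cos_two_pi_sub]
      have hmem : 2 * π - φ ∈ Icc 0 π := ⟨by linarith [hθ.2], by linarith⟩
      rw [hcos]
      constructor
      · intro h
        refine ⟨by linarith, ?_⟩
        by_contra hle; push Not at hle
        have hle' : 2 * π - φ ≤ arccos (S.kappa ε) := by linarith
        have : Real.cos (arccos (S.kappa ε)) ≤ Real.cos (2 * π - φ) :=
          (strictAntiOn_cos.le_iff_ge ⟨hA0, hAπ.le⟩ hmem).2 hle'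
        rw [hcosA] at this; linarith
      · rintro ⟨-, h2⟩
        have h2' : arccos (S.kappa ε) < 2 * π - φ := by linarith
        have : Real.cos (2 * π - φ) < Real.cos (arccos (S.kappa ε)) :=
          strictAntiOn_cos ⟨hA0, hAπ.le⟩ hmem h2'
        rwa [hcosA] at this
  rw [hiff, levelLo, levelHi, mem_Ioo, hφ]
  constructor <;> rintro ⟨h1, h2⟩ <;> constructor <;> linarith

/-- `I_α` is a nonempty interval of length `< 2π` inside `(arg c, arg c + 2π)`. [folklore] -/
theorem levelLo_lt_levelHi : S.levelLo ε < S.levelHi ε := by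
  have := arccos_lt_pi.2 (S.kappa_mem hε0 hε1 hcε).1
  rw [levelLo, levelHi]; linarith

/-- `I_α` has length `< 2π`. [folklore] -/
theorem levelHi_sub_levelLo_lt : S.levelHi ε - S.levelLo ε < 2 * π := by
  have := arccos_pos.2 (S.kappa_mem hε0 hε1 hcε).2
  rw [levelLo, levelHi]; linarith

omit hε0 hε1 hcε in
/-- Parameters of `I_α` are within `(0, 2π)` of `arg c`. [folklore] -/
theorem sub_arg_mem_of_mem_level {θ : ℝ} (hθ : θ ∈ Ioo (S.levelLo ε) (S.levelHi ε)) :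
    θ - arg S.c ∈ Ioo 0 (2 * π) := by
  have h1 := arccos_nonneg (S.kappa ε)
  rw [levelLo, levelHi, mem_Ioo] at hθ
  constructor <;> linarith [hθ.1, hθ.2]

/-- On `I_α` the circle is inside the disc. [folklore] -/
theorem circleMap_mem_ball {θ : ℝ} (hθ : θ ∈ Ioo (S.levelLo ε) (S.levelHi ε)) :
    circleMap S.c ε θ ∈ ball (0 : ℂ) 1 :=
  (S.circleMap_mem_ball_iff hε0 hε1 hcε (S.sub_arg_mem_of_mem_level hθ)).2 hθ

/-- **The level crosscut lies in the level set**: `α θ ∈ Ω` and `‖ψ (α θ) - c‖ = ε` for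
`θ ∈ I_α`. [cite: LawlerSchrammWerner2004, proof of Lemma 5.4] -/
theorem levelArc_mem {θ : ℝ} (hθ : θ ∈ Ioo (S.levelLo ε) (S.levelHi ε)) :
    S.levelArc ε θ ∈ S.Ω ∧ S.ψ (S.levelArc ε θ) = circleMap S.c ε θ ∧
      ‖S.ψ (S.levelArc ε θ) - S.c‖ = ε := by
  have hb := S.circleMap_mem_ball hε0 hε1 hcε hθ
  refine ⟨S.F_maps hb, S.ψ_F _ hb, ?_⟩
  rw [levelArc, S.ψ_F _ hb]
  simp [circleMap, abs_of_pos hε0]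

/-- `α` is continuous on `I_α`. [folklore] -/
theorem continuousOn_levelArc : ContinuousOn (S.levelArc ε) (Ioo (S.levelLo ε) (S.levelHi ε)) :=
  (S.F_cont.mono ball_subset_closedBall).comp (continuous_circleMap _ _).continuousOn
    fun _ hθ ↦ S.circleMap_mem_ball hε0 hε1 hcε hθ

/-- `α` is injective on `I_α`. [folklore] -/
theorem injOn_levelArc : InjOn (S.levelArc ε) (Ioo (S.levelLo ε) (S.levelHi ε)) := by
  intro u hu v hv huv
  have hFinj : InjOn S.F (ball 0 1) := fun w hw w' hw' h ↦ by
    rw [← S.ψ_F w hw, ← S.ψ_F w' hw', h]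
  have h := hFinj (S.circleMap_mem_ball hε0 hε1 hcε hu) (S.circleMap_mem_ball hε0 hε1 hcε hv) huv
  exact injOn_circleMap_of_lt hε0.ne' (S.levelHi_sub_levelLo_lt hε0 hε1 hcε)
    (Ioo_subset_Icc_self hu) (Ioo_subset_Icc_self hv) h

/-- **The level crosscut covers the level set**: every `z ∈ Ω` with `‖ψ z - c‖ = ε` is
`α θ` for some `θ ∈ I_α`. [cite: LawlerSchrammWerner2004, proof of Lemma 5.4] -/
theorem exists_levelArc_eq {z : ℂ} (hz : z ∈ S.Ω) (hzε : ‖S.ψ z - S.c‖ = ε) :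
    ∃ θ ∈ Ioo (S.levelLo ε) (S.levelHi ε), S.levelArc ε θ = z := by
  set w : ℂ := S.ψ z with hw
  have hwb : w ∈ ball (0 : ℂ) 1 := S.ψ_maps hz
  -- `w = c + ε e^{iθ₀}`, normalise `θ₀ - arg c ∈ (0, 2π]`
  set θ₀ : ℝ := arg (w - S.c) with hθ₀
  have hwθ₀ : w = circleMap S.c ε θ₀ := by
    have := norm_mul_exp_arg_mul_I (w - S.c)
    rw [hzε] at this
    rw [circleMap, this]; ring
  -- shift by a multiple of `2π`
  obtain ⟨n, hn⟩ : ∃ n : ℤ, θ₀ + n * (2 * π) - arg S.c ∈ Ioc 0 (2 * π) := by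
    have h2π : 0 < 2 * π := by positivity
    refine ⟨-toIocDiv h2π 0 (θ₀ - arg S.c), ?_⟩
    have hmem := toIocMod_mem_Ioc h2π 0 (θ₀ - arg S.c)
    rw [zero_add] at hmem
    have heq : θ₀ + ((-toIocDiv h2π 0 (θ₀ - arg S.c) : ℤ) : ℝ) * (2 * π) - arg S.c =
        toIocMod h2π 0 (θ₀ - arg S.c) := by
      rw [← self_sub_toIocDiv_zsmul, zsmul_eq_mul]; push_cast; ring
    rw [heq]; exact hmem
  set θ : ℝ := θ₀ + n * (2 * π) with hθdef
  have hwθ : w = circleMap S.c ε θ := by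
    rw [hwθ₀, hθdef]
    exact ((periodic_circleMap S.c ε).int_mul n θ₀).symm
  -- `θ - arg c ≠ 2π` since then `cos = 1 > κ` contradicts `w ∈ 𝔻`
  have hθ' : θ - arg S.c ∈ Ioo 0 (2 * π) := by
    refine ⟨hn.1, lt_of_le_of_ne hn.2 fun heq ↦ ?_⟩
    have hκ := (S.kappa_mem hε0 hε1 hcε).2
    have hden : 0 < 2 * ε * ‖S.c‖ := by have := S.norm_c_pos hε1 hcε; positivity
    have h1 : ‖w‖ ^ 2 < 1 := (sq_lt_one_iff₀ (norm_nonneg _)).2 (mem_ball_zero_iff.1 hwb)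
    rw [hwθ, S.norm_sq_circleMap, heq, Real.cos_two_pi] at h1
    rw [kappa, div_lt_one hden] at hκ
    linarith
  have hmem : θ ∈ Ioo (S.levelLo ε) (S.levelHi ε) :=
    (S.circleMap_mem_ball_iff hε0 hε1 hcε hθ').1 (hwθ ▸ hwb)
  refine ⟨θ, hmem, ?_⟩
  rw [levelArc, ← hwθ, hw, S.F_ψ z hz]

/-- `x` is not on the level crosscut (`‖ψ x - c‖ = 0`). [folklore] -/
theorem levelArc_ne_x {θ : ℝ} (hθ : θ ∈ Ioo (S.levelLo ε) (S.levelHi ε)) : S.levelArc ε θ ≠ S.x := by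
  intro h
  have := (S.levelArc_mem hε0 hε1 hcε hθ).2.2
  rw [h, show S.ψ S.x = S.c from rfl, sub_self, norm_zero] at this
  exact hε0.ne' this.symm

end Level

/-! ### The closed gates -/

/-- **The closed gates**: `gate 0 = (0, x]` (the segment off `0`), `gate 1 = σ [0, τ₊)`
(`A₂ ∪ {x}`), `gate 2 = σ (τ₋, 0]` (`A₃ ∪ {x}`). [cite: LawlerSchrammWerner2004, proof of Lemma 5.4] -/
def gate : Fin 3 → Set ℂ
  | 0 => segment ℝ 0 S.x ∩ S.Ω
  | 1 => S.sqLoop '' Ico 0 S.tauP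
  | 2 => S.sqLoop '' Ioc S.tauM 0

/-- Closed sets in `ℂ` cutting out the gates on `Ω`: `gateC 0 = [0, x]`, `gateC 1 = σ [0, τ₊]`,
`gateC 2 = σ [τ₋, 0]`. [folklore] -/
def gateC : Fin 3 → Set ℂ
  | 0 => segment ℝ 0 S.x
  | 1 => S.sqLoop '' Icc 0 S.tauP
  | 2 => S.sqLoop '' Icc S.tauM 0

/-- The sets `gateC m` are closed. [folklore] -/
theorem isClosed_gateC (m : Fin 3) : IsClosed (S.gateC m) := by
  match m with
  | 0 => exact S.isClosed_segment_x
  | 1 => exact (isCompact_Icc.image S.continuous_sqLoop).isClosed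
  | 2 => exact (isCompact_Icc.image S.continuous_sqLoop).isClosed

/-- `gate m = gateC m ∩ Ω`. [folklore] -/
theorem gate_eq (m : Fin 3) : S.gate m = S.gateC m ∩ S.Ω := by
  fin_cases m
  · rfl
  · show S.sqLoop '' Ico 0 S.tauP = S.sqLoop '' Icc 0 S.tauP ∩ S.Ω
    obtain ⟨hP, hnot, hin⟩ := S.tauP_spec
    ext z; constructor
    · rintro ⟨t, ht, rfl⟩; exact ⟨⟨t, Ico_subset_Icc_self ht, rfl⟩, hin t ht⟩
    · rintro ⟨⟨t, ht, rfl⟩, hz⟩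
      refine ⟨t, ⟨ht.1, lt_of_le_of_ne ht.2 fun h ↦ ?_⟩, rfl⟩
      rw [h] at hz; exact hnot hz
  · show S.sqLoop '' Ioc S.tauM 0 = S.sqLoop '' Icc S.tauM 0 ∩ S.Ω
    obtain ⟨hM, hnot, hin⟩ := S.tauM_spec
    ext z; constructor
    · rintro ⟨t, ht, rfl⟩; exact ⟨⟨t, Ioc_subset_Icc_self ht, rfl⟩, hin t ht⟩
    · rintro ⟨⟨t, ht, rfl⟩, hz⟩
      refine ⟨t, ⟨lt_of_le_of_ne ht.1 fun h ↦ ?_, ht.2⟩, rfl⟩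
      rw [← h] at hz; exact hnot hz

/-- The gates lie in `Ω`. [folklore] -/
theorem gate_subset_Ω (m : Fin 3) : S.gate m ⊆ S.Ω := by rw [gate_eq]; exact inter_subset_right

/-- The gates lie in the gate set `G`. [folklore] -/
theorem gate_subset_G (m : Fin 3) : S.gate m ⊆ S.G := by
  fin_cases m
  · exact fun z hz ↦ Or.inl hz.1
  · rintro _ ⟨t, -, rfl⟩; exact S.sqLoop_mem_G t
  · rintro _ ⟨t, -, rfl⟩; exact S.sqLoop_mem_G t

/-- `x` lies on every gate. [folklore] -/
theorem x_mem_gate (m : Fin 3) : S.x ∈ S.gate m := by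
  fin_cases m
  · exact ⟨right_mem_segment _ _ _, S.x_mem⟩
  · exact ⟨0, ⟨le_rfl, S.tauP_spec.1.1⟩, S.sqLoop_zero⟩
  · exact ⟨0, ⟨S.tauM_spec.1.2, le_rfl⟩, S.sqLoop_zero⟩

/-- Points of `gate 0` are `t x` with `0 < t ≤ 1`. [folklore] -/
theorem mem_gate_zero_iff {z : ℂ} : z ∈ S.gate 0 ↔ ∃ t ∈ Ioc (0 : ℝ) 1, z = (t : ℂ) * S.x := by
  show z ∈ segment ℝ 0 S.x ∩ S.Ω ↔ _
  rw [mem_inter_iff, S.mem_segment_iff]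
  constructor
  · rintro ⟨⟨t, ht, rfl⟩, hz⟩
    refine ⟨t, ⟨lt_of_le_of_ne ht.1 fun h ↦ ?_, ht.2⟩, rfl⟩
    rw [← h] at hz; simp at hz; exact S.zero_notMem hz
  · rintro ⟨t, ht, rfl⟩
    exact ⟨⟨t, ⟨ht.1.le, ht.2⟩, rfl⟩, S.smul_x_mem ht.1 ht.2⟩

/-- **The gates pairwise meet only at `x`.** [folklore] -/
theorem gate_inter_gate_subset {m m' : Fin 3} (h : m ≠ m') : S.gate m ∩ S.gate m' ⊆ {S.x} := by
  -- the segment meets `∂Q'` only at `x`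
  have hseg : ∀ z ∈ S.gate 0, sqn z = S.r → z = S.x := by
    intro z hz hsq
    obtain ⟨t, ht, rfl⟩ := S.mem_gate_zero_iff.1 hz
    rw [S.sqn_smul_x ht.1.le] at hsq
    have : t = 1 := by
      have := S.r_pos
      nlinarith [ht.2]
    rw [this]; simp
  -- the two arcs of `σ` meet only at `σ 0 = x`
  have harcs : ∀ z ∈ S.gate 1, z ∈ S.gate 2 → z = S.x := by
    rintro _ ⟨u, hu, rfl⟩ ⟨v, hv, huv⟩
    have hle : S.tauP - S.tauM ≤ 1 := S.tauP_sub_tauM_le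
    have hinj := S.isJordanLoop_sqLoop.injOn_Icc_of_lt (s := v) (t := u)
      (by linarith [hu.2, hv.1])
    have := hinj ⟨hv.2.trans hu.1, le_rfl⟩ ⟨le_rfl, hv.2.trans hu.1⟩ huv.symm
    -- `u = v`, with `v ≤ 0 ≤ u`
    have hu0 : u = 0 := le_antisymm (this ▸ hv.2) hu.1
    rw [hu0, sqLoop_zero]
  intro z hz
  rw [mem_singleton_iff]
  obtain ⟨hz1, hz2⟩ := hz
  fin_cases m <;> fin_cases m'
  · exact absurd rfl h
  · obtain ⟨t, -, rfl⟩ := hz2; exact hseg _ hz1 (S.sqn_sqLoop t)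
  · obtain ⟨t, -, rfl⟩ := hz2; exact hseg _ hz1 (S.sqn_sqLoop t)
  · obtain ⟨t, -, rfl⟩ := hz1; exact hseg _ hz2 (S.sqn_sqLoop t)
  · exact absurd rfl h
  · exact harcs _ hz1 hz2
  · obtain ⟨t, -, rfl⟩ := hz1; exact hseg _ hz2 (S.sqn_sqLoop t)
  · exact harcs _ hz2 hz1
  · exact absurd rfl h

/-- The gates are connected. [folklore] -/
theorem isPreconnected_gate (m : Fin 3) : IsPreconnected (S.gate m) := by
  match m with
  | 0 =>
    -- `(0, x]` is the image of `(0, 1]` under `t ↦ t x`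
    have : S.gate 0 = (fun t : ℝ ↦ (t : ℂ) * S.x) '' Ioc 0 1 := by
      ext z; rw [S.mem_gate_zero_iff]; constructor
      · rintro ⟨t, ht, rfl⟩; exact ⟨t, ht, rfl⟩
      · rintro ⟨t, ht, rfl⟩; exact ⟨t, ht, rfl⟩
    rw [this]
    exact isPreconnected_Ioc.image _ (by fun_prop)
  | 1 => exact isPreconnected_Ico.image _ S.continuous_sqLoop.continuousOn
  | 2 => exact isPreconnected_Ioc.image _ S.continuous_sqLoop.continuousOn

/-- **A gate that misses the level set `{‖ψ - c‖ = ε}` is conformally near**: all its points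
have `‖ψ z - c‖ < ε` (connectedness and `‖ψ x - c‖ = 0`). [folklore] -/
theorem gate_near_of_forall_ne {m : Fin 3} {ε : ℝ} (hε : 0 < ε)
    (h : ∀ z ∈ S.gate m, ‖S.ψ z - S.c‖ ≠ ε) : ∀ z ∈ S.gate m, ‖S.ψ z - S.c‖ < ε := by
  have hcont : ContinuousOn (fun z ↦ ‖S.ψ z - S.c‖) (S.gate m) :=
    ((S.ψ_cont.mono (S.gate_subset_Ω m)).sub continuousOn_const).norm
  have himg : IsPreconnected ((fun z ↦ ‖S.ψ z - S.c‖) '' S.gate m) :=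
    (S.isPreconnected_gate m).image _ hcont
  intro z hz
  by_contra hge
  push Not at hge
  have hgt : ε < ‖S.ψ z - S.c‖ := lt_of_le_of_ne hge (fun heq ↦ h z hz heq.symm)
  -- intermediate value between `x` (value `0`) and `z`
  have h0 : (0 : ℝ) ∈ (fun z ↦ ‖S.ψ z - S.c‖) '' S.gate m :=
    ⟨S.x, S.x_mem_gate m, by simp [Setup.c]⟩
  have h1 : ‖S.ψ z - S.c‖ ∈ (fun z ↦ ‖S.ψ z - S.c‖) '' S.gate m := ⟨z, hz, rfl⟩
  obtain ⟨y, hy, hyε⟩ := himg.Icc_subset h0 h1 ⟨hε.le, hgt.le⟩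
  exact h y hy hyε

end Setup

end ThreeChamber

end Literature.Analysis.Complex
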